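import Summits.CriticalPhenomena.SAWScalingLimit.Theses.SAWReversalUpgrade
import Summits.CriticalPhenomena.SAWScalingLimit.Theorems.SAWReversalUpgradeLawEventuallyProbability
import Literature.Probability.RandomPlanarGeometry.DrivingGermSampling
import Literature.Probability.RandomPlanarGeometry.DrivingFunctionMeasurable
import HarnessLib

/-!
# `stub_sampledOfGerm`: the sampled LSW key estimate from its germ normal form (line `lsw-engine`, crux `ForwardDriving`, stmt-CriticalPhenomena-18003)

Glue G1 of the lead's c1 reshape of line `lsw-engine` (`Cruxes/ForwardDriving/Lines/lsw_engine.lean`).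
The registered open stub of cycle a0, `stub_sampledKeyEstimate` (S1″: refining countable histories `H`,
a truncation index `τ`, validity of the capacity-sampled raw driving data of the attached walk, `P(τ < N) → 0`),
is implied by its GERM NORMAL FORM `stub_germKeyEstimate` (S1♮), which has no label type, no histories, no
truncation index and no adaptedness clause: S1♮ only says that the `SAW.law`-probability that some germ atom
(walks whose attached driving functions agree up to the current stopping capacity) below the horizon violates
one of the two Lawler–Schramm–Werner conditional-moment bounds tends to `0`.  The histories and the truncation
are manufactured canonically by `Literature/Probability/RandomPlanarGeometry/DrivingGermSampling.lean`
(`germHist` = code of the germ atom, `germTrunc` = first violating step, `germ_sampledData_isValid`,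
`setOf_germTrunc_lt`); this file instantiates that construction on the SAW space.
[cite: LawlerSchrammWerner2004, Theorem 3.7]
-/
noncomputable section

namespace Summit.CriticalPhenomena.SAWScalingLimit.Cruxes.ForwardDriving.LswEngine

open scoped BigOperators Topology Classical MeasureTheory ProbabilityTheory NNReal ENNReal
open scoped Literature.Probability.RandomPlanarGeometry.PathBorel
open Filter Set Function TopologicalSpace MeasureTheory
open Literature.Probability.RandomPlanarGeometry Literature.Probability.RandomPlanarGeometry.SkorokhodEmbedding

/-- **G1 `stub_sampledOfGerm`: the germ normal form S1♮ implies the sampled form S1″** of the LSW key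
estimate for the attached critical SAW, instance by instance. Given the constants, the mesoscopic scale
`dm`, the horizons `N` and the vanishing violation probability of S1♮, take label type `Λ := ℕ`, histories
`H δ k γ := germHist (W δ) (dm δ) k γ` (code of the germ atom of the attached driving function
`W δ γ = drivingFunction φ (mk (att δ γ))`) and the canonical truncation `τ δ := germTrunc law (W δ) (dm δ) (8/3) C₁ C₂ (N δ)`:
`{τ < N}` IS the violation event (`setOf_germTrunc_lt`), and for small `δ` the sampled data are valid
(`germ_sampledData_isValid`: the SAW law is a probability law on a finite space — `LawEventuallyProbability`,
`finite_domainSAW` —, `0 < dm δ`, `C₁ dm δ² ≤ 1` eventually as `dm → 0`, and `W δ γ 0 = 0` because the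
attached curve starts at `a = D.pt 0`, `drivingFunction_apply_zero`). [cite: LawlerSchrammWerner2004, Theorem 3.7] -/
theorem stub_sampledOfGerm :
    ∀ (D : Literature.Probability.RandomPlanarGeometry.DobrushinDomain) (a b : ℝ → Literature.Probability.LatticeModels.Site 2), Literature.Probability.RandomPlanarGeometry.SAW.IsEndpointApprox D a b → ∀ (φ : Literature.Probability.RandomPlanarGeometry.ConformalEquiv UpperHalfPlane.upperHalfPlaneSet D.carrier), D.IsChordalUniformizing φ → ∀ (att : ((δ : ℝ) → Literature.Probability.RandomPlanarGeometry.SAW.DomainSAW D.carrier δ (a δ) (b δ) → Literature.Probability.RandomPlanarGeometry.Curve ℂ)) (T : NNReal), (∀ᶠ δ in nhdsWithin (0:ℝ) (Set.Ioi 0), ∀ γ : Literature.Probability.RandomPlanarGeometry.SAW.DomainSAW D.carrier δ (a δ) (b δ), (att δ γ).source = D.pt 0) → (∃ (C₁ C₂ : ℝ) (dm : ℝ → ℝ) (N : ℝ → ℕ), 0 ≤ C₁ ∧ 0 ≤ C₂ ∧ Filter.Tendsto dm (nhdsWithin 0 (Set.Ioi 0)) (nhds 0) ∧ (∀ᶠ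 δ in nhdsWithin 0 (Set.Ioi 0), 0 < dm δ ∧ (8/3 + 2) * (T : ℝ) + 1 ≤ (N δ : ℝ) * (dm δ)^2 ∧ (N δ : ℝ) * (dm δ)^2 ≤ (8/3 + 2) * (T : ℝ) + 2) ∧ Filter.Tendsto (fun δ => Literature.Probability.RandomPlanarGeometry.SAW.law D.carrier δ (a δ) (b δ) {γ | ∃ k < N δ, Literature.Probability.RandomPlanarGeometry.SkorokhodEmbedding.germViol (Literature.Probability.RandomPlanarGeometry.SAW.law D.carrier δ (a δ) (b δ)) (fun γ' => (⟨Literature.Probability.RandomPlanarGeometry.drivingFunction φ (Literature.Probability.RandomPlanarGeometry.CurveClass.mk (att δ γ')), Literature.Probability.RandomPlanarGeometry.continuous_drivingFunction φ (Literature.Probability.RandomPlanarGeometry.CurveClass.mk (att δ γ'))⟩ : C(NNReal, ℝ))) (dm δ) (8/3) C₁ C₂ k γ}) (nhdsWithin 0 (Set.Ioi 0)) (nhds 0)) → (∃ (Λ : Type) (_ : DecidableEq Λ) (_ : MeasurableSpace Λ) (_ : Countable Λ) (_ : MeasurableSingletonClass Λ) (C₁ C₂ : ℝ) (dm : ℝ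 → ℝ) (H : (δ : ℝ) → ℕ → Literature.Probability.RandomPlanarGeometry.SAW.DomainSAW D.carrier δ (a δ) (b δ) → Λ) (τ : (δ : ℝ) → Literature.Probability.RandomPlanarGeometry.SAW.DomainSAW D.carrier δ (a δ) (b δ) → ℕ) (N : ℝ → ℕ), 0 ≤ C₁ ∧ 0 ≤ C₂ ∧ Filter.Tendsto dm (nhdsWithin 0 (Set.Ioi 0)) (nhds 0) ∧ Filter.Tendsto (fun δ => Literature.Probability.RandomPlanarGeometry.SAW.law D.carrier δ (a δ) (b δ) {γ | τ δ γ < N δ}) (nhdsWithin 0 (Set.Ioi 0)) (nhds 0) ∧ ∀ᶠ δ in nhdsWithin 0 (Set.Ioi 0), ∃ (_ : Fintype (Literature.Probability.RandomPlanarGeometry.SAW.DomainSAW D.carrier δ (a δ) (b δ))), (Literature.Probability.RandomPlanarGeometry.SkorokhodEmbedding.sampledData (Literature.Probability.RandomPlanarGeometry.SAW.law D.carrier δ (a δ) (b δ)) (H δ) (fun γ => (⟨Literature.Probability.RandomPlanarGeometry.drivingFunction φ (Literature.Probability.RandomPlanarGeometry.CurveClass.mk (att δ γ)), Literature.Probability.RandomPlanarGeometry.continuous_drivingFunction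 φ (Literature.Probability.RandomPlanarGeometry.CurveClass.mk (att δ γ))⟩ : C(NNReal, ℝ))) (τ δ) (dm δ) (8/3) C₁ C₂).IsValid (N δ) ∧ (8/3 + 2) * (T : ℝ) + 1 ≤ (N δ : ℝ) * (dm δ)^2 ∧ (N δ : ℝ) * (dm δ)^2 ≤ (8/3 + 2) * (T : ℝ) + 2) := by
  intro D a b happ φ hφ att T hsrc h
  obtain ⟨C₁, C₂, dm, N, hC₁, hC₂, hdm, hwin, hviol⟩ := h
  set W : (δ : ℝ) → Literature.Probability.RandomPlanarGeometry.SAW.DomainSAW D.carrier δ (a δ) (b δ) →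
      C(NNReal, ℝ) := fun δ γ' =>
    (⟨Literature.Probability.RandomPlanarGeometry.drivingFunction φ
        (Literature.Probability.RandomPlanarGeometry.CurveClass.mk (att δ γ')),
      Literature.Probability.RandomPlanarGeometry.continuous_drivingFunction φ
        (Literature.Probability.RandomPlanarGeometry.CurveClass.mk (att δ γ'))⟩ : C(NNReal, ℝ)) with hW
  set μ : (δ : ℝ) → Measure (Literature.Probability.RandomPlanarGeometry.SAW.DomainSAW D.carrier δ (a δ) (b δ)) :=
    fun δ => Literature.Probability.RandomPlanarGeometry.SAW.law D.carrier δ (a δ) (b δ) with hμ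
  refine ⟨ℕ, inferInstance, inferInstance, inferInstance, inferInstance, C₁, C₂, dm,
    fun δ => germHist (W δ) (dm δ), fun δ => germTrunc (μ δ) (W δ) (dm δ) (8 / 3) C₁ C₂ (N δ), N,
    hC₁, hC₂, hdm, ?_, ?_⟩
  · -- `P(τ < N) → 0`: the truncation event is the violation event of S1♮
    have hset : ∀ δ, {γ | germTrunc (μ δ) (W δ) (dm δ) (8 / 3) C₁ C₂ (N δ) γ < N δ} =
        {γ | ∃ k < N δ, germViol (μ δ) (W δ) (dm δ) (8 / 3) C₁ C₂ k γ} := fun δ =>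
      setOf_germTrunc_lt (N δ)
    simp only [hset]
    exact hviol
  · -- eventual validity in the window
    have hC₁dm : ∀ᶠ δ in nhdsWithin (0:ℝ) (Set.Ioi 0), C₁ * (dm δ) ^ 2 ≤ 1 := by
      have ht : Tendsto (fun δ => C₁ * (dm δ) ^ 2) (nhdsWithin (0:ℝ) (Set.Ioi 0)) (nhds (C₁ * 0 ^ 2)) :=
        (hdm.pow 2).const_mul C₁
      rw [zero_pow two_ne_zero, mul_zero] at ht
      exact (ht.eventually (eventually_lt_nhds zero_lt_one)).mono fun δ h => h.le
    filter_upwards [hwin,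
      Summit.CriticalPhenomena.SAWScalingLimit.Theorems.SAWLoopFugacityFlowAssembly.eventually_isProbabilityMeasure_law
        happ, hsrc, self_mem_nhdsWithin, hC₁dm] with δ hw hP hs hδ hC
    haveI : Finite (Literature.Probability.RandomPlanarGeometry.SAW.DomainSAW D.carrier δ (a δ) (b δ)) :=
      Summit.CriticalPhenomena.SAWScalingLimit.Theorems.SAWLoopFugacityFlowAssembly.finite_domainSAW
        D.isBounded (Set.mem_Ioi.1 hδ) (a δ) (b δ)
    haveI : MeasurableSingletonClass
        (Literature.Probability.RandomPlanarGeometry.SAW.DomainSAW D.carrier δ (a δ) (b δ)) :=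
      ⟨fun _ => MeasurableSpace.measurableSet_top⟩
    letI : Fintype (Literature.Probability.RandomPlanarGeometry.SAW.DomainSAW D.carrier δ (a δ) (b δ)) :=
      Fintype.ofFinite _
    have h0 : ∀ γ, W δ γ 0 = 0 := fun γ =>
      Literature.Probability.RandomPlanarGeometry.drivingFunction_apply_zero hφ
        (by rw [Literature.Probability.RandomPlanarGeometry.CurveClass.source_mk]; exact hs γ)
    exact ⟨inferInstance, germ_sampledData_isValid hP hw.1 hC (by norm_num) hC₁ hC₂ h0, hw.2.1, hw.2.2⟩

end Summit.CriticalPhenomena.SAWScalingLimit.Cruxes.ForwardDriving.LswEngine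

end
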